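import Mathlib.RingTheory.OrderOfVanishing.Basic
import Mathlib.RingTheory.DiscreteValuationRing.Basic
import Mathlib.RingTheory.Length
import Mathlib.LinearAlgebra.Isomorphisms
import Literature.Algebra.Module.DVRModuleType
import Literature.Algebra.Module.CyclicModuleSubmodules
import Literature.Algebra.Module.PIDInvariantFactors
import Literature.Algebra.Module.HomModulesElementaryProperties
import Literature.Algebra.Module.TorsionHomCountingDVR
import HarnessLib

/-!
# Duality for torsion pairings over a discrete valuation ring: perfectness by counting, annihilator lengths,
# exponent transfer, and the colength inequality in `(R/(ϖᵏ))²` (the linear algebra of Howard 2004,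
# Lemmas 1.5.6–1.5.8 and Proposition 1.5.9)

Topic `Algebra/Module`; namespace `Literature.Algebra.Module` (sequel to `TorsionHomCountingDVR.lean`; continued
in `LagrangianSubmodulesSplitPairing.lean`). THEOREMS ONLY: no definition, no named fact, no instance, no
`sorry`. Cell `pub/bsd-print-x9`, print leaf G87
`Literature.NumberTheory.GaloisCohomology.Howard2004.thm161_dvrKolyvaginBound` (Howard 2004 Thm. 1.6.1), input
Lemma 1.6.4 ⟸ §1.5. The Galois-cohomological inputs of §1.5 (global duality, reciprocity, the localisation
maps) stay with the consumer as hypotheses in the shape they print; this file is the module theory.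

SOURCE. B. Howard, *The Heegner point Kolyvagin system*, Compositio Math. **140** (2004) 1439–1472, §1.5
(= arXiv:1202.6340 §2.5, held text p0010 L80 – p0011 L13). Lemma 1.5.6: «the
image of `𝓗^m(n)` in `⊕_{λ∣m} H¹(K_λ,T)` is maximal isotropic […] The sum of the lengths of `A` and `A^⊥` must
be `4k·ν(m)` and we conclude that `len(A) = len(A^⊥)` and so `A = A^⊥`.» Lemma 1.5.8: «There are `a`, `b`,
and `δ` greater than or equal to zero such that in the following diagram the cokernel of each inclusion is a
direct sum of two cyclic `R`-modules of the indicated lengths.» Prop. 1.5.9: «`loc_ℓ(Stub(n)) = 0 ⟹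
loc_ℓ(Stub(ℓn)) = 0`. *Proof.* […] `loc_ℓ(Stub(n)) = 0` implies that `𝔪^{λ(n)}` kills the lower left quotient,
and so `a, b ≤ λ(n)`. The diagram immediately implies `λ(nℓ) = λ(n) + k − a − b − δ ≥ k − a − δ, k − b − δ` so
that `𝔪^{λ(nℓ)}` kills the lower right quotient.» Here `R` is principal Artinian of length `k`, i.e. `R/(ϖᵏ)`
for a DVR with uniformiser `ϖ`, and `H¹_f(K_λ,T)`, `H¹_tr(K_λ,T)` are free of rank two (arXiv p0009 L105–108).

WHAT IS PROVED (`R` a DVR with uniformiser `ϖ`; `P` with cyclic `ϖ`-torsion as in the prequel; a pairing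
`B : M → Hom_R(N, P)`, `N` finitely generated with `ϖᵏN = 0`):
* §2 **`bijective_of_injective_of_length_le`** — left non-degenerate + `ℓ(N) ≤ ℓ(M) < ∞` ⟹ every `R`-linear
  `N → P` is `B(m, ·)` (perfectness by the counting «`len A + len A^⊥ = 4k`»);
  **`length_le_length_quotient_of_forall_apply_eq_zero`** — `S ⟂ T ⟹ ℓ(S) ≤ ℓ(N/T)`;
  **`pow_smul_top_le_of_forall_mem`** — if `S` contains the annihilator of `T` and `P` has an element of exact
  order `ϖᵏ`, then `ϖʲS = 0 ⟹ ϖʲN ≤ T` («`𝔪^λ` kills the lower left quotient ⟹ `a, b ≤ λ`» read through the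
  duality).
* §3 **`natCast_add_length_span_singleton_le`** — the COLENGTH INEQUALITY in `N ≅ (R/(ϖᵏ))²`: `ϖʲN ≤ X`,
  `x ∈ X` ⟹ `k + ℓ(Rx) ≤ j + ℓ(X)` (modular law for `ϖʲN + Rx ≤ X`; `ϖʲN ∩ Rx` is a submodule of the cyclic
  `Rx` killed by `ϖ^{k−j}`, of length `≤ k − j`). In elementary divisors: «`X ≅ R/(ϖ^{x₁}) ⊕ R/(ϖ^{x₂})`,
  `N/X ≅ R/(ϖ^{k−x₁}) ⊕ R/(ϖ^{k−x₂})`» — the shape of the four cokernels in Lemma 1.5.8's diagram; only the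
  inequality is used downstream.

NOT HERE: the Lagrangian submodule `A = A^⊥` of `H¹_f ⊕ H¹_tr`, Howard's pairing `[x,y] = ⟨x_f, y_tr⟩`
(Lemma 1.5.7) and the transfer of Prop. 1.5.9 itself — in the sequel; anything Galois-cohomological;
`thm161_dvrKolyvaginBound` is NOT proved by this file. References: [Howard2004HeegnerKolyvagin] §1.5;
[Kaplansky1954] §11; [Fuchs1970] §43.
-/

noncomputable section

open Module Submodule
open scoped Pointwise

namespace Literature.Algebra.Module

universe u v w

section DVR

variable {R : Type u} [CommRing R] [IsDomain R] [IsDiscreteValuationRing R] {ϖ : R}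
variable {N : Type v} [AddCommGroup N] [Module R N]
variable {P : Type w} [AddCommGroup P] [Module R P]

/-! ### §2 Duality for a pairing `B : M × N → P` -/

section Pairing

variable {M : Type*} [AddCommGroup M] [Module R M]

/-- **Injective + length count ⇒ perfect.** If `B : M → Hom(N, P)` is injective (left non-degenerate),
`N` is finitely generated with `ϖᵏN = 0`, `P` has cyclic `ϖ`-torsion and `ℓ(N) ≤ ℓ(M) < ∞`, then `B` is
bijective: every `R`-linear `N → P` is `B(m, ·)`. [cite: Howard2004HeegnerKolyvagin, Lemma 1.5.6, proof
(arXiv:1202.6340 Lemma 2.5.6, p0010 L84–L102: «The sum of the lengths of A and A^⊥ must be 4k·ν(m)»)] -/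
theorem bijective_of_injective_of_length_le (hϖ : Irreducible ϖ) [Module.Finite R N] {k : ℕ}
    (hN : ∀ n : N, ϖ ^ k • n = 0)
    (hP : ∀ p q : P, ϖ • p = 0 → ϖ • q = 0 → p ≠ 0 → ∃ r : R, q = r • p)
    (B : M →ₗ[R] N →ₗ[R] P) (hinj : Function.Injective B)
    (hlen : Module.length R N ≤ Module.length R M) (hM : Module.length R M ≠ ⊤) :
    Function.Bijective B := by
  refine ⟨hinj, ?_⟩
  have h1 : Module.length R (N →ₗ[R] P) ≤ Module.length R M :=
    (length_linearMap_le hϖ hN hP).trans hlen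
  have h2 : Module.length R (LinearMap.range B) = Module.length R M :=
    (LinearEquiv.ofInjective B hinj).length_eq.symm
  have h3 : Module.length R (LinearMap.range B) = Module.length R (N →ₗ[R] P) :=
    le_antisymm (Module.length_le_of_injective _ (injective_subtype _)) (h2 ▸ h1)
  have hfin : Module.length R (N →ₗ[R] P) ≠ ⊤ := ne_top_of_le_ne_top hM h1
  exact LinearMap.range_eq_top.mp (eq_top_of_length_eq_of_ne_top hfin h3)

/-- **Annihilator length bound**: if `B : M → Hom(N, P)` is injective and `S ≤ M` pairs to zero with
`T ≤ N`, then `ℓ(S) ≤ ℓ(N/T)` (`S ↪ Hom(N/T, P)` and `ℓ(Hom(N/T, P)) ≤ ℓ(N/T)`).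
[cite: Howard2004HeegnerKolyvagin, Lemma 1.5.6, proof (arXiv:1202.6340 Lemma 2.5.6, p0010 L94–L102)] -/
theorem length_le_length_quotient_of_forall_apply_eq_zero (hϖ : Irreducible ϖ) [Module.Finite R N]
    {k : ℕ} (hN : ∀ n : N, ϖ ^ k • n = 0)
    (hP : ∀ p q : P, ϖ • p = 0 → ϖ • q = 0 → p ≠ 0 → ∃ r : R, q = r • p)
    (B : M →ₗ[R] N →ₗ[R] P) (hinj : Function.Injective B)
    (S : Submodule R M) (T : Submodule R N) (hS : ∀ m ∈ S, ∀ t ∈ T, B m t = 0) :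
    Module.length R S ≤ Module.length R (N ⧸ T) := by
  have hle : ∀ m : S, T ≤ LinearMap.ker (B (m : M)) := fun m t ht => by
    rw [LinearMap.mem_ker]
    exact hS m m.2 t ht
  let Φ : S →ₗ[R] ((N ⧸ T) →ₗ[R] P) :=
    { toFun := fun m => T.liftQ (B (m : M)) (hle m)
      map_add' := fun m m' => by
        apply Submodule.linearMap_qext
        rw [Submodule.liftQ_mkQ, LinearMap.add_comp, Submodule.liftQ_mkQ, Submodule.liftQ_mkQ,
          Submodule.coe_add, map_add]
      map_smul' := fun r m => by
        apply Submodule.linearMap_qext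
        rw [Submodule.liftQ_mkQ, RingHom.id_apply, LinearMap.smul_comp, Submodule.liftQ_mkQ,
          Submodule.coe_smul, map_smul] }
  have hΦ : Function.Injective Φ := by
    intro m m' h
    apply Subtype.ext
    apply hinj
    have := congrArg (fun f : (N ⧸ T) →ₗ[R] P => f ∘ₗ T.mkQ) h
    simpa only [Φ, LinearMap.coe_mk, AddHom.coe_mk, Submodule.liftQ_mkQ] using this
  have hNT : ∀ q : N ⧸ T, ϖ ^ k • q = 0 := by
    intro q
    obtain ⟨n, rfl⟩ := Submodule.Quotient.mk_surjective T q
    rw [← Submodule.Quotient.mk_smul, hN, Submodule.Quotient.mk_zero]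
  exact (Module.length_le_of_injective Φ hΦ).trans (length_linearMap_le hϖ hNT hP)

/-- **Exponent transfer through a perfect pairing**: if every `R`-linear `N → P` is of the form `B(m, ·)`,
`P` contains an element `p₀` of exact order `ϖᵏ`, `N` is finitely generated with `ϖᵏN = 0`, and `S ≤ M`
contains every `m` annihilating `T ≤ N`, then `ϖʲS = 0` forces `ϖʲN ⊆ T` (a functional on `N/T` not
vanishing at the class of `ϖʲn` would come from an `m ∈ S` with `ϖʲm ≠ 0`).
[cite: Howard2004HeegnerKolyvagin, Prop. 1.5.9, proof (arXiv:1202.6340 Prop. 2.5.9, p0011 L5–L12)] -/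
theorem pow_smul_top_le_of_forall_mem (hϖ : Irreducible ϖ) [Module.Finite R N] {k : ℕ}
    (hN : ∀ n : N, ϖ ^ k • n = 0) (B : M →ₗ[R] N →ₗ[R] P) (hsurj : Function.Surjective B)
    {p₀ : P} (hp₀ : ϖ ^ k • p₀ = 0) (hp₀' : ∀ r : R, r • p₀ = 0 → ϖ ^ k ∣ r)
    (S : Submodule R M) (T : Submodule R N) (hS : ∀ m : M, (∀ t ∈ T, B m t = 0) → m ∈ S)
    {j : ℕ} (hj : ∀ m ∈ S, ϖ ^ j • m = 0) : ϖ ^ j • (⊤ : Submodule R N) ≤ T := by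
  intro y hy
  obtain ⟨n, -, rfl⟩ := (Submodule.mem_smul_pointwise_iff_exists y (ϖ ^ j) ⊤).mp hy
  by_contra hnT
  have hne : T.mkQ (ϖ ^ j • n) ≠ 0 := by
    rwa [Ne, Submodule.mkQ_apply, Submodule.Quotient.mk_eq_zero]
  have hNT : ∀ q : N ⧸ T, ϖ ^ k • q = 0 := by
    intro q
    obtain ⟨n, rfl⟩ := Submodule.Quotient.mk_surjective T q
    rw [← Submodule.Quotient.mk_smul, hN, Submodule.Quotient.mk_zero]
  obtain ⟨φ, hφ⟩ := exists_linearMap_apply_ne_zero hϖ hNT hp₀ hp₀' hne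
  obtain ⟨m, hm⟩ := hsurj (φ ∘ₗ T.mkQ)
  have hmS : m ∈ S := hS m fun t ht => by
    have : B m t = φ (T.mkQ t) := by rw [← LinearMap.comp_apply, ← hm]
    rw [this, Submodule.mkQ_apply, (Submodule.Quotient.mk_eq_zero T).mpr ht, map_zero]
  apply hφ
  calc φ (T.mkQ (ϖ ^ j • n)) = B m (ϖ ^ j • n) := by rw [← LinearMap.comp_apply, hm]
    _ = ϖ ^ j • B m n := map_smul _ _ _
    _ = B (ϖ ^ j • m) n := by rw [map_smul, LinearMap.smul_apply]
    _ = 0 := by rw [hj m hmS, map_zero, LinearMap.zero_apply]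

end Pairing

/-! ### §3 The colength inequality in a free `R/(ϖᵏ)`-module of rank two -/

/-- **Colength inequality.** Let `N ≅ (R/(ϖᵏ))²`, `X ≤ N` a submodule containing `ϖʲN`, and `x ∈ X`.
Then `k + ℓ(Rx) ≤ j + ℓ(X)`: with `C = Rx`, `ℓ(ϖʲN + C) + ℓ(ϖʲN ∩ C) = ℓ(ϖʲN) + ℓ(C) = 2(k−j) + ℓ(C)`
and `ϖʲN ∩ C` is a submodule of the cyclic `C` killed by `ϖ^{k−j}`, of length `≤ k − j`. (In elementary
divisors: `X ≅ R/(ϖ^{x₁}) ⊕ R/(ϖ^{x₂})` and `N/X ≅ R/(ϖ^{k−x₁}) ⊕ R/(ϖ^{k−x₂})` — the shape of the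
cokernels in Howard's diagram of Lemma 1.5.8.)
[cite: Howard2004HeegnerKolyvagin, Lemma 1.5.8 / Prop. 1.5.9 (arXiv:1202.6340 Lemma 2.5.8, p0010 L142–L154; Prop. 2.5.9, p0011 L3–L13)] -/
theorem natCast_add_length_span_singleton_le (hϖ : Irreducible ϖ) {k : ℕ}
    (eN : N ≃ₗ[R] (Fin 2 → R ⧸ Ideal.span {ϖ ^ k})) (X : Submodule R N) {j : ℕ}
    (hj : ϖ ^ j • (⊤ : Submodule R N) ≤ X) {x : N} (hx : x ∈ X) :
    (k : ℕ∞) + Module.length R ↥(R ∙ x) ≤ j + Module.length R X := by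
  have hCX : (R ∙ x) ≤ X := (span_singleton_le_iff_mem _ _).mpr hx
  by_cases hjk : k ≤ j
  · exact add_le_add (Nat.cast_le.mpr hjk)
      (Module.length_le_of_injective _ (Submodule.inclusion_injective hCX))
  push Not at hjk
  have hNk : ∀ n : N, ϖ ^ k • n = 0 := uniformizer_pow_smul_eq_zero_of_linearEquiv eN
  -- `ℓ(ϖ^j N) = 2 (k - j)`
  have h1 : Module.length R ↥(ϖ ^ j • (⊤ : Submodule R N)) = 2 * ((k - j : ℕ) : ℕ∞) := by
    obtain ⟨e1⟩ := nonempty_smul_top_linearEquiv_of_linearEquiv eN (ϖ ^ j)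
    obtain ⟨e2⟩ := nonempty_smul_top_pi_linearEquiv (N := fun _ : Fin 2 => R ⧸ Ideal.span {ϖ ^ k})
      (ϖ ^ j)
    obtain ⟨e3⟩ := nonempty_smul_top_quotient_linearEquiv_of_mul (R := R) (r := ϖ ^ k) (s := ϖ ^ j)
      (k := ϖ ^ (k - j)) (by rw [← pow_add, Nat.add_sub_cancel' hjk.le]) (pow_ne_zero _ hϖ.ne_zero)
    rw [e1.length_eq, e2.length_eq, Module.length_pi_of_fintype, Finset.sum_const, Finset.card_univ,
      Fintype.card_fin, e3.length_eq, length_quotient_uniformizer_pow hϖ, two_mul, two_nsmul]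
  -- `ℓ(ϖ^j N ∩ Rx) ≤ k - j`
  have h2 : Module.length R ↥(ϖ ^ j • (⊤ : Submodule R N) ⊓ (R ∙ x)) ≤ ((k - j : ℕ) : ℕ∞) := by
    let ι : ↥(ϖ ^ j • (⊤ : Submodule R N) ⊓ (R ∙ x)) →ₗ[R] ↥(torsionBy R ↥(R ∙ x) (ϖ ^ (k - j))) :=
      { toFun := fun y => ⟨⟨(y : N), y.2.2⟩, by
          rw [mem_torsionBy_iff]
          apply Subtype.ext
          obtain ⟨n, -, hn⟩ := (Submodule.mem_smul_pointwise_iff_exists _ (ϖ ^ j) ⊤).mp y.2.1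
          change ϖ ^ (k - j) • (y : N) = 0
          rw [← hn, smul_smul, pow_sub_mul_pow ϖ hjk.le, hNk]⟩
        map_add' := fun _ _ => rfl
        map_smul' := fun _ _ => rfl }
    have hι : Function.Injective ι := by
      intro y y' h
      apply Subtype.ext
      exact congrArg (fun z : ↥(torsionBy R ↥(R ∙ x) (ϖ ^ (k - j))) => ((z : ↥(R ∙ x)) : N)) h
    exact (Module.length_le_of_injective ι hι).trans
      (length_torsionBy_pow_le hϖ (span_singleton_uniformizer_torsion_cyclic hϖ x) (k - j))
  have h3 := length_sup_add_length_inf (ϖ ^ j • (⊤ : Submodule R N)) (R ∙ x)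
  have h4 : Module.length R ↥(ϖ ^ j • (⊤ : Submodule R N) ⊔ (R ∙ x)) ≤ Module.length R X :=
    Module.length_le_of_injective _ (Submodule.inclusion_injective (sup_le hj hCX))
  have hfin : ((k - j : ℕ) : ℕ∞) ≠ ⊤ := ENat.coe_ne_top _
  have key : ((k - j : ℕ) : ℕ∞) + Module.length R ↥(R ∙ x) ≤ Module.length R X := by
    rw [← ENat.add_le_add_iff_right hfin]
    calc ((k - j : ℕ) : ℕ∞) + Module.length R ↥(R ∙ x) + ((k - j : ℕ) : ℕ∞)
        = Module.length R ↥(ϖ ^ j • (⊤ : Submodule R N) ⊔ (R ∙ x)) +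
            Module.length R ↥(ϖ ^ j • (⊤ : Submodule R N) ⊓ (R ∙ x)) := by
          rw [h3, h1]
          ring
      _ ≤ Module.length R X + ((k - j : ℕ) : ℕ∞) := add_le_add h4 h2
  calc (k : ℕ∞) + Module.length R ↥(R ∙ x)
      = (j : ℕ∞) + (((k - j : ℕ) : ℕ∞) + Module.length R ↥(R ∙ x)) := by
        rw [← add_assoc, ← Nat.cast_add, Nat.add_sub_cancel' hjk.le]
    _ ≤ j + Module.length R X := add_le_add le_rfl key

/-! ### §4 Generators, orders and a test element for the sequel -/

/-- **Submodules of `(R/(ϖᵏ))²` are two-generated**: for `X ≤ N ≅ (Fin 2 → R/(ϖᵏ))` there are `x₁, x₂ ∈ X`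
with `X = R x₁ + R x₂` (lift to `R²`, where a submodule of a free rank-two module over a PID is free of rank
`≤ 2`). Howard: «Since `𝓗^ℓ(n)/𝓗(n)` injects into `H¹_s(K_ℓ,T)` which is free of rank 2, it follows that
`𝓗^ℓ(n)/(𝓗(n)+𝓗(ℓn))` can be generated by two elements.»
[cite: Howard2004HeegnerKolyvagin, Lemma 1.5.7, proof (arXiv:1202.6340 Lemma 2.5.7, p0010 L136–L139)] -/
theorem exists_eq_span_pair {k : ℕ} (eN : N ≃ₗ[R] (Fin 2 → R ⧸ Ideal.span {ϖ ^ k}))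
    (X : Submodule R N) : ∃ x₁ ∈ X, ∃ x₂ ∈ X, X = Submodule.span R {x₁, x₂} := by
  classical
  let q : (Fin 2 → R) →ₗ[R] (Fin 2 → R ⧸ Ideal.span {ϖ ^ k}) :=
    ((Ideal.span {ϖ ^ k}).mkQ).compLeft (Fin 2)
  have hq : Function.Surjective q := fun y => by
    refine ⟨fun i => (Submodule.Quotient.mk_surjective _ (y i)).choose, funext fun i => ?_⟩
    exact (Submodule.Quotient.mk_surjective _ (y i)).choose_spec
  let Xt : Submodule R (Fin 2 → R) := (X.map (eN : N →ₗ[R] Fin 2 → R ⧸ Ideal.span {ϖ ^ k})).comap q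
  obtain ⟨n, bX⟩ := Submodule.basisOfPid (Pi.basisFun R (Fin 2)) Xt
  have hn : n ≤ 2 := by
    have hli : LinearIndependent R (fun i => (bX i : Fin 2 → R)) :=
      bX.linearIndependent.map' Xt.subtype (Submodule.ker_subtype Xt)
    simpa using hli.fintype_card_le_finrank
  let g : Fin n → N := fun i => eN.symm (q (bX i))
  have hg : ∀ i, g i ∈ X := fun i => by
    have h := (bX i).2
    rw [Submodule.mem_comap, Submodule.mem_map] at h
    obtain ⟨x, hx, hxe⟩ := h
    change eN.symm (q (bX i)) ∈ X
    rw [← hxe, LinearEquiv.coe_coe, LinearEquiv.symm_apply_apply]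
    exact hx
  have hX : X ≤ Submodule.span R (Set.range g) := by
    intro x hx
    obtain ⟨c, hc⟩ := hq (eN x)
    have hcXt : c ∈ Xt := by
      rw [Submodule.mem_comap, hc]
      exact Submodule.mem_map_of_mem hx
    obtain ⟨d, hd⟩ : ∃ d : Fin n → R, c = ∑ i, d i • (bX i : Fin 2 → R) := by
      refine ⟨fun i => bX.repr ⟨c, hcXt⟩ i, ?_⟩
      have h := congrArg Subtype.val (bX.sum_repr ⟨c, hcXt⟩)
      rw [Submodule.coe_sum] at h
      simp only [Submodule.coe_smul] at h
      exact h.symm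
    have hxg : x = ∑ i, d i • g i := by
      apply eN.injective
      rw [← hc, hd, map_sum, map_sum]
      refine Finset.sum_congr rfl fun i _ => ?_
      rw [map_smul, map_smul]
      change _ = d i • eN (eN.symm (q (bX i)))
      rw [LinearEquiv.apply_symm_apply]
    rw [hxg]
    exact Submodule.sum_mem _ fun i _ => Submodule.smul_mem _ _ (Submodule.subset_span ⟨i, rfl⟩)
  have key : ∀ x₁ x₂ : N, x₁ ∈ X → x₂ ∈ X → Set.range g ⊆ {x₁, x₂} →
      ∃ x₁ ∈ X, ∃ x₂ ∈ X, X = Submodule.span R {x₁, x₂} := by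
    intro x₁ x₂ h₁ h₂ hsub
    refine ⟨x₁, h₁, x₂, h₂, le_antisymm (hX.trans (Submodule.span_mono hsub)) ?_⟩
    rw [Submodule.span_le]
    rintro y (rfl | rfl)
    · exact h₁
    · exact h₂
  interval_cases n
  · exact key 0 0 X.zero_mem X.zero_mem (by rintro _ ⟨i, -⟩; exact Fin.elim0 i)
  · exact key (g 0) 0 (hg 0) X.zero_mem (by
      rintro _ ⟨i, rfl⟩
      fin_cases i
      exact Or.inl rfl)
  · exact key (g 0) (g 1) (hg 0) (hg 1) (by
      rintro _ ⟨i, rfl⟩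
      fin_cases i
      · exact Or.inl rfl
      · exact Or.inr rfl)

/-- **Length of a cyclic submodule = order**: if `ϖᵏx = 0` then for some `m`, `ℓ(Rx) = m` and `ϖᵐx = 0`
(`ann(x) = (ϖᵐ)`, `Rx ≅ R/(ϖᵐ)`). [cite: Kaplansky1954, §11 (PDF p. 29)] -/
theorem exists_length_span_singleton_eq_and_pow_smul_eq_zero (hϖ : Irreducible ϖ) {k : ℕ} {x : N}
    (hx : ϖ ^ k • x = 0) : ∃ m : ℕ, Module.length R ↥(R ∙ x) = m ∧ ϖ ^ m • x = 0 := by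
  have hI : Ideal.torsionOf R N x ≠ ⊥ := by
    intro h
    have : ϖ ^ k ∈ Ideal.torsionOf R N x := (Ideal.mem_torsionOf_iff x _).mpr hx
    rw [h, Ideal.mem_bot] at this
    exact pow_ne_zero k hϖ.ne_zero this
  obtain ⟨m, hm⟩ := IsDiscreteValuationRing.ideal_eq_span_pow_irreducible hI hϖ
  refine ⟨m, ?_, ?_⟩
  · rw [← (Ideal.quotTorsionOfEquivSpanSingleton R N x).length_eq, hm]
    exact length_quotient_uniformizer_pow hϖ m
  · rw [← Ideal.mem_torsionOf_iff x, hm]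
    exact Ideal.mem_span_singleton_self _

/-- **A test element of exact order `ϖᵏ`** in the value module: if `C : N → Hom_R(M, P)` is injective and
`N ≅ (R/(ϖᵏ))²`, then some value `p₀ = C(t₀)(f)` has `ϖᵏp₀ = 0` and `ann(p₀) ⊆ (ϖᵏ)` (for `k ≥ 1` take `t₀`
of order `ϖᵏ` and `f` with `C(ϖ^{k−1}t₀)(f) ≠ 0`). [cite: Howard2004HeegnerKolyvagin, Lemma 1.5.6, proof (arXiv:1202.6340 Lemma 2.5.6, p0010 L94–L102)] -/
theorem exists_smul_eq_zero_and_dvd_of_injective (hϖ : Irreducible ϖ) {k : ℕ} {M : Type*}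
    [AddCommGroup M] [Module R M] (eN : N ≃ₗ[R] (Fin 2 → R ⧸ Ideal.span {ϖ ^ k}))
    (C : N →ₗ[R] M →ₗ[R] P) (hC : Function.Injective C) :
    ∃ p₀ : P, ϖ ^ k • p₀ = 0 ∧ ∀ r : R, r • p₀ = 0 → ϖ ^ k ∣ r := by
  classical
  rcases Nat.eq_zero_or_pos k with hk | hk
  · exact ⟨0, smul_zero _, fun r _ => by rw [hk, pow_zero]; exact one_dvd r⟩
  let t₀ : N := eN.symm (Pi.single 0 1)
  have ht₀ : ϖ ^ (k - 1) • t₀ ≠ 0 := by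
    intro h
    have h1 : ϖ ^ (k - 1) • (Pi.single 0 1 : Fin 2 → R ⧸ Ideal.span {ϖ ^ k}) = 0 := by
      have := congrArg eN h
      rwa [map_smul, map_zero, LinearEquiv.apply_symm_apply] at this
    have h2 : (Ideal.Quotient.mk (Ideal.span {ϖ ^ k}) (ϖ ^ (k - 1))) = 0 := by
      have := congrFun h1 0
      rw [Pi.smul_apply, Pi.single_eq_same, Pi.zero_apply, Algebra.smul_def, mul_one,
        Ideal.Quotient.algebraMap_eq] at this
      exact this
    rw [Ideal.Quotient.eq_zero_iff_mem, Ideal.mem_span_singleton] at h2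
    have := (pow_dvd_pow_iff hϖ.ne_zero hϖ.not_isUnit).mp h2
    omega
  have hCt : C (ϖ ^ (k - 1) • t₀) ≠ 0 := fun h => ht₀ (hC (by rw [h, map_zero]))
  obtain ⟨f, hf⟩ : ∃ f : M, C (ϖ ^ (k - 1) • t₀) f ≠ 0 := by
    by_contra h
    push Not at h
    exact hCt (LinearMap.ext h)
  refine ⟨C t₀ f, ?_, fun r hr => ?_⟩
  · rw [← LinearMap.smul_apply, ← map_smul, uniformizer_pow_smul_eq_zero_of_linearEquiv eN, map_zero,
      LinearMap.zero_apply]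
  rcases eq_or_ne r 0 with rfl | hr0
  · exact dvd_zero _
  obtain ⟨m, u, rfl⟩ := IsDiscreteValuationRing.eq_unit_mul_pow_irreducible hr0 hϖ
  by_cases hmk : k ≤ m
  · exact dvd_mul_of_dvd_right (pow_dvd_pow ϖ hmk) _
  · exfalso
    push Not at hmk
    have hm : ϖ ^ m • C t₀ f = 0 := by
      rw [mul_smul, ← Units.smul_def] at hr
      exact (smul_eq_zero_iff_eq u).mp hr
    apply hf
    have hle : m ≤ k - 1 := by omega
    rw [map_smul, LinearMap.smul_apply, ← pow_sub_mul_pow ϖ hle, mul_smul, hm, smul_zero]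

end DVR

end Literature.Algebra.Module
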